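import Summits.BirchSwinnertonDyer.BirchSwinnertonDyer.Theorems.GenusKolyvaginAtTwoMultiGenusPrimitivityAtTwoAuxiliaryFieldTwist
import Summits.BirchSwinnertonDyer.BirchSwinnertonDyer.Theorems.GenusKolyvaginAtTwoGenusPrimitiveSupplyAtTwoLevelOneTower
import Summits.BirchSwinnertonDyer.BirchSwinnertonDyer.Theorems.GenusKolyvaginAtTwoMultiGenusPrimitivityAtTwoOfStubs

/-!
# Route `GenusKolyvaginAtTwo`, crux stmt-BirchSwinnertonDyer-24947 `MultiGenusPrimitivityAtTwo` (U): the auxiliary-field certificate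
# at DEPTH ONE on `M₀ ≥ 1` (the registered stub `stub_positiveDepth`), and U BY NAME from its depth-one auxiliary-field form

Lead prover seat bsd-line-gk2-p1 (g6); sequel to `…AuxiliaryField` (p611810), `…AuxiliaryFieldTwist` (p613997), `…OfAuxField`
(p615396). Those files work at DEPTH-2 Kolyvagin primes (`4 ∣ a_ℓ`), where the certificate is one genus point with NO hypothesis on
`M₀`. On the open stub `stub_positiveDepth` (= U with McCallum's `M₀ ≥ 1`: `2 ∣ P(1)` in `E(K[1])`) the one-point reduction already
holds at EVERY Kolyvagin prime (depth one, `2 ∣ a_ℓ`): `P(ℓ) ∈ 2E(K[ℓ]) ⟺ Y_ℓ ∈ 4E(K[ℓ])` (g3's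
`…LevelOneTower.heegner_exists_two_zsmul_eq_derivedPoint_iff_four_dvd_genusCharacterPoint_of_levelOne`). This file rewrites that in the
reduced-genus-point currency and through the auxiliary field:
* §1 `heegner_not_two_dvd_reducedGenusPoint_iff_auxField` — the depth-free core of p611810: for ANY point `R` that is `χ_ℓ`-isotypic
  together with all its `2`-power roots … (stated for the reduced genus point `W_ℓ`, `2·W_ℓ = Y_ℓ`): `W_ℓ ∉ 2E(K[ℓ])` iff no odd
  multiple of `W_ℓ` is twice a `ℚ(θ_ℓ)`-rational point (`τ ∉ Gal(K[ℓ]/K)`, `τθ_ℓ = −θ_ℓ`, `τ`-fixed isotypic points torsion);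
* §2 `heegner_certificate_iff_reducedGenusPoint_of_levelOne` — on `M₀ ≥ 1`, at ANY Kolyvagin prime `ℓ` at `2`: certificate clause
  `Σ_{g∈T} g·y(ℓ) ∉ 2E(K[ℓ])` ⟺ `W_ℓ ∉ 2E(K[ℓ])`; hence (`…_iff_auxField_of_levelOne…`) ⟺ the auxiliary-field statement, with the
  rank hypothesis discharged onto «`#Sel₂` of an elliptic model of the EVEN genus twist `W^{(ℓ*·d)}` is `1`» (p613997);
* §3 `multiGenusPrimitivityAtTwo_of_auxFieldPrimitive_levelOne` — U BY NAME (via g4's `…OfStubs`, `stub_levelOne` PROVED) from the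
  DEPTH-ONE auxiliary-field form of `stub_positiveDepth`. This is the form that COMPOSES with gk2-p4's twisting-prime supply
  (p612667/p614125: Kolyvagin primes of depth one with prescribed 2-Selmer localisations; capstone «Sel₂-minimal genus pair» mod
  `cor34i`): on WALL row 1 the open kernel is then exactly «at a supplied prime whose even genus twist is Sel₂-trivial, the reduced genus
  point is `2`-primitive in `E(ℚ(√ℓ*)) ⊗ ℤ₂`» — W. Zhang's base case of Kolyvagin's conjecture at `p = 2` (crux memo
  `Lines/genus-supply-local.md`). Helper (`--supports stmt-BirchSwinnertonDyer-24947`); no named fact; BSD is not proved by any of this.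

References: [GrossLMS1991] §3 (3.5), Prop. 3.7 (1), §4 (4.1), Lemma 4.3, §5; [McCallumLMS1991] §5; [Cox2013] §9.A Lemma 9.3;
[SilvermanAEC2009] X.2 Prop. 2.4, X.4.2, VIII.6.7.
-/

set_option linter.dupNamespace false -- tree convention: `Summit.BirchSwinnertonDyer.BirchSwinnertonDyer.Theorems` (summit = sub-problem)

noncomputable section

open scoped Classical

namespace Summit.BirchSwinnertonDyer.BirchSwinnertonDyer.Theorems.GenusKoly

open Finset NumberField WeierstrassCurve Literature.NumberTheory.EllipticCurves
  Literature.NumberTheory.EllipticCurves.ModularForms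

section Heegner

variable {W : WeierstrassCurve ℚ} [NeZero (W.conductorNorm ℤ)] {K : Type} [Field K] [NumberField K]
  {Dt : ModularParametrizationData W (W.conductorNorm ℤ)} {β : ℤ} {ι : K →+* ℂ}

/-! ### §1 The depth-free core: `W_ℓ ∉ 2E(K[ℓ])` iff no odd multiple is twice a `ℚ(θ_ℓ)`-rational point -/

/-- **`2`-primitivity of the reduced genus point ⟺ its auxiliary-field form** (depth-free; the core of p611810's
`heegner_certificate_iff_forall_odd_not_two_dvd_in_auxField`): on the crux's frame at level `ℓ ≠ 0` with radicals `θ`, `G`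
enumerating `Gal(K[ℓ]/K)`, `W_ℓ` with `2^{#primes}·W_ℓ = Y_ℓ`, `τ ∉ Gal(K[ℓ]/K)` with `τθ_ℓ = −θ_ℓ` (`ℓ` prime) and the `τ`-fixed
`χ_ℓ`-points torsion: `W_ℓ ∉ 2E(K[ℓ])` iff no odd multiple of `W_ℓ` is twice a point fixed by every automorphism fixing `θ_ℓ`.
[cite: GrossLMS1991, §4 Lemma 4.3, §5] [cite: Cox2013, §9.A Lemma 9.3] -/
theorem heegner_not_two_dvd_reducedGenusPoint_iff_auxField [W.IsElliptic] [W.IsGloballyMinimal]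
    (hK : IsImaginaryQuadratic K) (hodd : Odd (NumberField.discr K))
    (hH : SatisfiesHeegnerHypothesis (W.conductorNorm ℤ) K) (hsurj : W.HasSurjectiveModNGaloisRep ((2 : ℤ) ^ 1))
    {ℓ : ℕ} (hℓ : ℓ.Prime) (d : KolyvaginHeegnerData Dt β ι ℓ) {θ : ℕ → ringClassField K ι ℓ}
    (hθ : ∀ ℓ' ∈ ℓ.primeFactors, θ ℓ' ^ 2 = algebraMap ℚ (ringClassField K ι ℓ) ((-1 : ℚ) ^ (ℓ' / 2) * ℓ'))
    (G : Finset (ringClassField K ι ℓ ≃ₐ[ℚ] ringClassField K ι ℓ)) (hG : ∀ g, g ∈ G ↔ g ∈ ringClassGal ι ℓ)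
    {τ : ringClassField K ι ℓ ≃ₐ[ℚ] ringClassField K ι ℓ} (hτ : τ ∉ ringClassGal ι ℓ) (hτθ : τ (θ ℓ) = -θ ℓ)
    (hR0 : ∀ S : (W.baseChange (ringClassField K ι ℓ)).toAffine.Point,
      (∀ h ∈ ringClassGal ι ℓ, pointGalHom W (ringClassField K ι ℓ) h S =
        (∏ ℓ' ∈ ℓ.primeFactors, (if h (θ ℓ') = θ ℓ' then (1 : ℤ) else -1)) • S) →
      pointGalHom W (ringClassField K ι ℓ) τ S = S → IsOfFinAddOrder S)
    {Wn : (W.baseChange (ringClassField K ι ℓ)).toAffine.Point}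
    (hWn : ((2 : ℤ) ^ ℓ.primeFactors.card) • Wn =
      ∑ g ∈ G, (∏ ℓ' ∈ ℓ.primeFactors, (if g (θ ℓ') = θ ℓ' then (1 : ℤ) else -1)) •
        pointGalHom W (ringClassField K ι ℓ) g d.y) :
    (¬ ∃ Q : (W.baseChange (ringClassField K ι ℓ)).toAffine.Point, (2 : ℤ) • Q = Wn) ↔
      ∀ m : ℕ, Odd m → ¬ ∃ Q : (W.baseChange (ringClassField K ι ℓ)).toAffine.Point,
        (∀ g : ringClassField K ι ℓ ≃ₐ[ℚ] ringClassField K ι ℓ, g (θ ℓ) = θ ℓ →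
          pointGalHom W (ringClassField K ι ℓ) g Q = Q) ∧ (2 : ℤ) • Q = (m : ℤ) • Wn := by
  constructor
  · rintro hcert m ⟨k, hk⟩ ⟨Q, -, hQ⟩
    refine hcert ⟨Q - (k : ℤ) • Wn, ?_⟩
    have h2 : (2 : ℤ) • Q = (2 * (k : ℤ) + 1) • Wn := by rw [hQ, hk]; norm_cast
    calc (2 : ℤ) • (Q - (k : ℤ) • Wn) = (2 : ℤ) • Q - (2 * (k : ℤ)) • Wn := by rw [smul_sub, smul_smul]
      _ = (2 * (k : ℤ) + 1) • Wn - (2 * (k : ℤ)) • Wn := by rw [h2]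
      _ = Wn := by rw [← sub_smul, add_sub_cancel_left, one_smul]
  · rintro hno ⟨Q, hQ⟩
    have hQiso : ∀ h ∈ ringClassGal ι ℓ, pointGalHom W (ringClassField K ι ℓ) h Q =
        (∏ ℓ' ∈ ℓ.primeFactors, (if h (θ ℓ') = θ ℓ' then (1 : ℤ) else -1)) • Q := fun h hh ↦
      heegner_reducedGenusPoint_half_isotypic hK hodd hH hsurj hℓ.ne_zero d hθ G hG hWn hQ hh
    obtain ⟨m, hm, -, hrat⟩ :=
      heegner_isotypic_exists_odd_smul_mem_auxField hK hodd hH hsurj hℓ hθ hτ hτθ hR0 hQiso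
    exact hno m hm ⟨(m : ℤ) • Q, hrat, by rw [smul_comm, hQ]⟩

/-! ### §2 Depth ONE on `M₀ ≥ 1`: certificate ⟺ `W_ℓ ∉ 2E(K[ℓ])` ⟺ the auxiliary-field form -/

omit [NeZero (W.conductorNorm ℤ)] in
/-- The top genus sum in product currency is `Σ_{T⁺} − Σ_{T⁻}` at prime level. [folklore] -/
theorem heegner_genusSum_eq_sub_of_prime {ℓ : ℕ} (hℓ : ℓ.Prime) {θ : ℕ → ringClassField K ι ℓ}
    (hθ : ∀ ℓ' ∈ ℓ.primeFactors, θ ℓ' ^ 2 = algebraMap ℚ (ringClassField K ι ℓ) ((-1 : ℚ) ^ (ℓ' / 2) * ℓ'))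
    (G : Finset (ringClassField K ι ℓ ≃ₐ[ℚ] ringClassField K ι ℓ))
    (y : (W.baseChange (ringClassField K ι ℓ)).toAffine.Point) :
    ∑ g ∈ G, (∏ ℓ' ∈ ℓ.primeFactors, (if g (θ ℓ') = θ ℓ' then (1 : ℤ) else -1)) • pointGalHom W (ringClassField K ι ℓ) g y =
      ∑ g ∈ G.filter (fun g ↦ g (θ ℓ) = θ ℓ), pointGalHom W (ringClassField K ι ℓ) g y -
        ∑ g ∈ G.filter (fun g ↦ g (θ ℓ) = -θ ℓ), pointGalHom W (ringClassField K ι ℓ) g y := by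
  have hPF : ℓ.primeFactors = {ℓ} := Nat.Prime.primeFactors hℓ
  have hℓmem : ℓ ∈ ℓ.primeFactors := by rw [hPF]; exact Finset.mem_singleton_self ℓ
  have hθ0 : θ ℓ ≠ 0 := ne_zero_of_sq_eq_pStar hℓ (hθ ℓ hℓmem)
  simp_rw [hPF, Finset.prod_singleton, ite_smul, one_smul, neg_one_smul]
  rw [Finset.sum_ite, Finset.sum_neg_distrib, ← sub_eq_add_neg]
  congr 1
  refine Finset.sum_congr (Finset.filter_congr fun g _ ↦ ?_) fun _ _ ↦ rfl
  rcases algEquiv_apply_eq_or_eq_neg_of_sq_eq (hθ ℓ hℓmem) g with h | h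
  · rw [h]; exact ⟨fun h' ↦ absurd rfl h', fun h' ↦ absurd h' (ne_neg_of_ne_zero hθ0)⟩
  · rw [h]; exact ⟨fun _ ↦ rfl, fun _ h' ↦ ne_neg_of_ne_zero hθ0 h'.symm⟩

/-- **On `M₀ ≥ 1`, at ANY Kolyvagin prime at `2`, the certificate clause is the `2`-primitivity of the reduced genus point**: crux's
frame, `ℓ` a Kolyvagin prime at `2` (`2 ∣ a_ℓ` — depth one suffices), `d₁` of conductor `1` with `2 ∣ P(1)` in `E(K[1])` (McCallum's
`M₀ ≥ 1`, the hypothesis of the registered stub `stub_positiveDepth`), `d` of conductor `ℓ`, radicals, `G`, `T`, and `W_ℓ` with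
`2·W_ℓ = Y_ℓ` (`…DepthLaw`, depth one): `Σ_{g∈T} g·y(ℓ) ∉ 2E(K[ℓ]) ⟺ W_ℓ ∉ 2E(K[ℓ])`. (g3's `…of_levelOne` criterion
`P(ℓ) ∈ 2E ⟺ Y_ℓ ∈ 4E` + the multi-genus/derived-point dictionary + `E(K[ℓ])[2] = 0`.)
[cite: GrossLMS1991, §3 (3.5), Prop. 3.7 (1), §4 (4.1), Lemma 4.3] [cite: McCallumLMS1991, §5 (M₀)] -/
theorem heegner_certificate_iff_reducedGenusPoint_of_levelOne [W.IsElliptic] [W.IsGloballyMinimal]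
    (hK : IsImaginaryQuadratic K) (hodd : Odd (NumberField.discr K)) (h3 : NumberField.discr K ≠ -3)
    (hH : SatisfiesHeegnerHypothesis (W.conductorNorm ℤ) K) (hsurj : W.HasSurjectiveModNGaloisRep ((2 : ℤ) ^ 1))
    {ℓ : ℕ} (hℓ : ℓ.Prime) (hKoly : ∀ ℓ' ∈ ℓ.primeFactors, Zhang2014.IsKolyvaginPrime (W.conductorNorm ℤ) W K 2 ℓ')
    (d₁ : KolyvaginHeegnerData Dt β ι 1)
    (hM : ∃ Q₁ : (W.baseChange (ringClassField K ι 1)).toAffine.Point, (2 : ℤ) • Q₁ = d₁.derivedPoint)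
    (d : KolyvaginHeegnerData Dt β ι ℓ) {θ : ℕ → ringClassField K ι ℓ}
    (hθ : ∀ ℓ' ∈ ℓ.primeFactors, θ ℓ' ^ 2 = algebraMap ℚ (ringClassField K ι ℓ) ((-1 : ℚ) ^ (ℓ' / 2) * ℓ'))
    (G : Finset (ringClassField K ι ℓ ≃ₐ[ℚ] ringClassField K ι ℓ)) (hG : ∀ g, g ∈ G ↔ g ∈ ringClassGal ι ℓ)
    (T : Finset (ringClassField K ι ℓ ≃ₐ[ℚ] ringClassField K ι ℓ))
    (hT : ∀ g, g ∈ T ↔ g ∈ ringClassGal ι ℓ ∧ ∀ ℓ' ∈ ℓ.primeFactors, g (θ ℓ') = θ ℓ')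
    {Wn : (W.baseChange (ringClassField K ι ℓ)).toAffine.Point}
    (hWn : ((2 : ℤ) ^ ℓ.primeFactors.card) • Wn =
      ∑ g ∈ G, (∏ ℓ' ∈ ℓ.primeFactors, (if g (θ ℓ') = θ ℓ' then (1 : ℤ) else -1)) •
        pointGalHom W (ringClassField K ι ℓ) g d.y) :
    (¬ ∃ Q : (W.baseChange (ringClassField K ι ℓ)).toAffine.Point, (2 : ℤ) • Q =
        ∑ g ∈ T, pointGalHom W (ringClassField K ι ℓ) g d.y) ↔
      ¬ ∃ Q : (W.baseChange (ringClassField K ι ℓ)).toAffine.Point, (2 : ℤ) • Q = Wn := by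
  haveI : Fact (Nat.Prime 2) := ⟨Nat.prime_two⟩
  have hPF : ℓ.primeFactors = {ℓ} := Nat.Prime.primeFactors hℓ
  have hℓmem : ℓ ∈ ℓ.primeFactors := by rw [hPF]; exact Finset.mem_singleton_self ℓ
  have hD : NumberField.discr K < -4 := discr_lt_neg_four_of_odd hK hodd h3
  have htors := heegner_two_torsion_free (ι := ι) hK hodd hH hsurj hℓ.ne_zero
  have hKℓ := hKoly ℓ hℓmem
  obtain ⟨hθ0, hσ, -⟩ := heegner_genusRadicals_table hK (Irreducible.squarefree hℓ) hKoly d hθ ℓ hℓmem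
  have hflip : ∃ τ ∈ ringClassGalOver ι ℓ 1, τ (θ ℓ) = -θ ℓ :=
    ⟨d.σ ℓ, by simpa using heegner_sigma_pow_mem hℓ d 1, hσ⟩
  -- certificate ⟺ `P(ℓ) ∉ 2E` ⟺ `Y_ℓ ∉ 4E` (depth one, `M₀ ≥ 1`)
  rw [← heegner_exists_two_zsmul_eq_derivedPoint_iff_multiGenusTrace hK hD hH (Irreducible.squarefree hℓ) hKoly d hθ T hT,
    heegner_exists_two_zsmul_eq_derivedPoint_iff_four_dvd_genusCharacterPoint_of_levelOne hK hodd h3 hH hsurj hℓ hKℓ.2.2.2.2.1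
      hKℓ.2.1 (by exact_mod_cast hKℓ.dvd.2) d₁ d (hθ ℓ hℓmem) hθ0 hflip (G.filter (fun g ↦ g (θ ℓ) = θ ℓ))
      (G.filter (fun g ↦ g (θ ℓ) = -θ ℓ)) (fun g ↦ by rw [Finset.mem_filter, hG]) (fun g ↦ by rw [Finset.mem_filter, hG]) hM,
    ← heegner_genusSum_eq_sub_of_prime hℓ hθ G d.y, ← hWn, hPF, Finset.card_singleton, pow_one]
  -- `∃ R, 4R = 2W ⟺ ∃ Q, 2Q = W` (no `2`-torsion)
  refine not_congr ⟨fun ⟨R, hR⟩ ↦ ⟨R, ?_⟩, fun ⟨Q, hQ⟩ ↦ ⟨Q, by rw [← hQ, smul_smul]; norm_num⟩⟩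
  have h0 : (2 : ℤ) • ((2 : ℤ) • R - Wn) = 0 := by
    rw [smul_sub, smul_smul, show ((2 : ℤ) * 2) = 4 by norm_num, hR, sub_self]
  exact sub_eq_zero.mp (htors _ h0)

/-- **Depth ONE, `M₀ ≥ 1`: the certificate in the auxiliary field** (with `τ` displayed). Same frame as
`heegner_certificate_iff_reducedGenusPoint_of_levelOne`, plus `τ ∉ Gal(K[ℓ]/K)` with `τθ_ℓ = −θ_ℓ` and the `τ`-fixed `χ_ℓ`-points
torsion: certificate clause ⟺ no odd multiple of `W_ℓ` is twice a `ℚ(θ_ℓ)`-rational point.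
[cite: GrossLMS1991, §3 (3.5), §4 (4.1), Lemma 4.3, §5] [cite: McCallumLMS1991, §5] [cite: Cox2013, §9.A Lemma 9.3] -/
theorem heegner_certificate_iff_auxField_of_levelOne [W.IsElliptic] [W.IsGloballyMinimal]
    (hK : IsImaginaryQuadratic K) (hodd : Odd (NumberField.discr K)) (h3 : NumberField.discr K ≠ -3)
    (hH : SatisfiesHeegnerHypothesis (W.conductorNorm ℤ) K) (hsurj : W.HasSurjectiveModNGaloisRep ((2 : ℤ) ^ 1))
    {ℓ : ℕ} (hℓ : ℓ.Prime) (hKoly : ∀ ℓ' ∈ ℓ.primeFactors, Zhang2014.IsKolyvaginPrime (W.conductorNorm ℤ) W K 2 ℓ')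
    (d₁ : KolyvaginHeegnerData Dt β ι 1)
    (hM : ∃ Q₁ : (W.baseChange (ringClassField K ι 1)).toAffine.Point, (2 : ℤ) • Q₁ = d₁.derivedPoint)
    (d : KolyvaginHeegnerData Dt β ι ℓ) {θ : ℕ → ringClassField K ι ℓ}
    (hθ : ∀ ℓ' ∈ ℓ.primeFactors, θ ℓ' ^ 2 = algebraMap ℚ (ringClassField K ι ℓ) ((-1 : ℚ) ^ (ℓ' / 2) * ℓ'))
    (G : Finset (ringClassField K ι ℓ ≃ₐ[ℚ] ringClassField K ι ℓ)) (hG : ∀ g, g ∈ G ↔ g ∈ ringClassGal ι ℓ)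
    (T : Finset (ringClassField K ι ℓ ≃ₐ[ℚ] ringClassField K ι ℓ))
    (hT : ∀ g, g ∈ T ↔ g ∈ ringClassGal ι ℓ ∧ ∀ ℓ' ∈ ℓ.primeFactors, g (θ ℓ') = θ ℓ')
    {τ : ringClassField K ι ℓ ≃ₐ[ℚ] ringClassField K ι ℓ} (hτ : τ ∉ ringClassGal ι ℓ) (hτθ : τ (θ ℓ) = -θ ℓ)
    (hR0 : ∀ S : (W.baseChange (ringClassField K ι ℓ)).toAffine.Point,
      (∀ h ∈ ringClassGal ι ℓ, pointGalHom W (ringClassField K ι ℓ) h S =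
        (∏ ℓ' ∈ ℓ.primeFactors, (if h (θ ℓ') = θ ℓ' then (1 : ℤ) else -1)) • S) →
      pointGalHom W (ringClassField K ι ℓ) τ S = S → IsOfFinAddOrder S)
    {Wn : (W.baseChange (ringClassField K ι ℓ)).toAffine.Point}
    (hWn : ((2 : ℤ) ^ ℓ.primeFactors.card) • Wn =
      ∑ g ∈ G, (∏ ℓ' ∈ ℓ.primeFactors, (if g (θ ℓ') = θ ℓ' then (1 : ℤ) else -1)) •
        pointGalHom W (ringClassField K ι ℓ) g d.y) :
    (¬ ∃ Q : (W.baseChange (ringClassField K ι ℓ)).toAffine.Point, (2 : ℤ) • Q =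
        ∑ g ∈ T, pointGalHom W (ringClassField K ι ℓ) g d.y) ↔
      ∀ m : ℕ, Odd m → ¬ ∃ Q : (W.baseChange (ringClassField K ι ℓ)).toAffine.Point,
        (∀ g : ringClassField K ι ℓ ≃ₐ[ℚ] ringClassField K ι ℓ, g (θ ℓ) = θ ℓ →
          pointGalHom W (ringClassField K ι ℓ) g Q = Q) ∧ (2 : ℤ) • Q = (m : ℤ) • Wn := by
  rw [heegner_certificate_iff_reducedGenusPoint_of_levelOne hK hodd h3 hH hsurj hℓ hKoly d₁ hM d hθ G hG T hT hWn]
  exact heegner_not_two_dvd_reducedGenusPoint_iff_auxField hK hodd hH hsurj hℓ d hθ G hG hτ hτθ hR0 hWn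

/-- **Depth ONE, `M₀ ≥ 1`, `τ`-FREE: the certificate in the auxiliary field on the Sel₂-trivial even genus twist.** Crux frame,
Kolyvagin prime `ℓ` at `2` (depth one), `2 ∣ P(1)`, `√d ∈ K ∖ ℚ`, an elliptic model `Wd` of `W^{(ℓ*·d)}` with `#Sel₂(Wd) = 1`:
certificate clause ⟺ no odd multiple of `W_ℓ` is twice a `ℚ(θ_ℓ)`-rational point. This is the form that composes with a depth-one
twisting-prime SUPPLY (gk2-p4's `…TwistingPrimeKolyvagin` / `…TwistingPrimeTwin`).
[cite: GrossLMS1991, §3 (3.5), §4 (4.1), Lemma 4.3, §5] [cite: McCallumLMS1991, §5] [cite: SilvermanAEC2009, X.2 Prop. 2.4, X.4.2, VIII.6.7] -/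
theorem heegner_certificate_iff_auxField_of_levelOne_of_card_selmerGroup_evenTwist_eq_one [W.IsElliptic] [W.IsGloballyMinimal]
    (hK : IsImaginaryQuadratic K) (hodd : Odd (NumberField.discr K)) (h3 : NumberField.discr K ≠ -3)
    (hH : SatisfiesHeegnerHypothesis (W.conductorNorm ℤ) K) (hsurj : W.HasSurjectiveModNGaloisRep ((2 : ℤ) ^ 1))
    {ℓ : ℕ} (hℓ : ℓ.Prime) (hKoly : ∀ ℓ' ∈ ℓ.primeFactors, Zhang2014.IsKolyvaginPrime (W.conductorNorm ℤ) W K 2 ℓ')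
    (d₁ : KolyvaginHeegnerData Dt β ι 1)
    (hM : ∃ Q₁ : (W.baseChange (ringClassField K ι 1)).toAffine.Point, (2 : ℤ) • Q₁ = d₁.derivedPoint)
    (d : KolyvaginHeegnerData Dt β ι ℓ) {θ : ℕ → ringClassField K ι ℓ}
    (hθ : ∀ ℓ' ∈ ℓ.primeFactors, θ ℓ' ^ 2 = algebraMap ℚ (ringClassField K ι ℓ) ((-1 : ℚ) ^ (ℓ' / 2) * ℓ'))
    (G : Finset (ringClassField K ι ℓ ≃ₐ[ℚ] ringClassField K ι ℓ)) (hG : ∀ g, g ∈ G ↔ g ∈ ringClassGal ι ℓ)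
    (T : Finset (ringClassField K ι ℓ ≃ₐ[ℚ] ringClassField K ι ℓ))
    (hT : ∀ g, g ∈ T ↔ g ∈ ringClassGal ι ℓ ∧ ∀ ℓ' ∈ ℓ.primeFactors, g (θ ℓ') = θ ℓ')
    {s₀ : K} (hs₀ : s₀ ∉ Set.range (algebraMap ℚ K)) {dK : ℚ} (hs₀2 : s₀ ^ 2 = algebraMap ℚ K dK)
    (Wd : WeierstrassCurve ℚ) [Wd.IsElliptic]
    (hC : ∃ C : WeierstrassCurve.VariableChange ℚ, C • W.quadraticTwist (((-1 : ℚ) ^ (ℓ / 2) * ℓ) * dK) = Wd)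
    (hSel : Nat.card (Wd.selmerGroup 2) = 1)
    {Wn : (W.baseChange (ringClassField K ι ℓ)).toAffine.Point}
    (hWn : ((2 : ℤ) ^ ℓ.primeFactors.card) • Wn =
      ∑ g ∈ G, (∏ ℓ' ∈ ℓ.primeFactors, (if g (θ ℓ') = θ ℓ' then (1 : ℤ) else -1)) •
        pointGalHom W (ringClassField K ι ℓ) g d.y) :
    (¬ ∃ Q : (W.baseChange (ringClassField K ι ℓ)).toAffine.Point, (2 : ℤ) • Q =
        ∑ g ∈ T, pointGalHom W (ringClassField K ι ℓ) g d.y) ↔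
      ∀ m : ℕ, Odd m → ¬ ∃ Q : (W.baseChange (ringClassField K ι ℓ)).toAffine.Point,
        (∀ g : ringClassField K ι ℓ ≃ₐ[ℚ] ringClassField K ι ℓ, g (θ ℓ) = θ ℓ →
          pointGalHom W (ringClassField K ι ℓ) g Q = Q) ∧ (2 : ℤ) • Q = (m : ℤ) • Wn := by
  obtain ⟨τ, hτ, hτθ⟩ := heegner_exists_not_mem_ringClassGal_apply_theta_eq_neg hK hℓ hKoly d hθ
  exact heegner_certificate_iff_auxField_of_levelOne hK hodd h3 hH hsurj hℓ hKoly d₁ hM d hθ G hG T hT hτ hτθ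
    (heegner_conjFixed_isotypic_isOfFinAddOrder_of_twist hK hℓ hθ hs₀ hs₀2
      (heegner_theta_mul_sqrt_not_mem_range hK hℓ hKoly d hθ hs₀)
      (finite_point_of_card_selmerGroup_two_eq_one _ Wd hC hSel) hτ hτθ) hWn

/-- **Pointwise supply of the stub's `∃`-clause from the depth-ONE auxiliary-field form** (on `M₀ ≥ 1`): some Kolyvagin prime `ℓ`
at `2` with data `d`, radicals, `G`, `√d ∈ K ∖ ℚ`, an elliptic model of the even genus twist with `#Sel₂ = 1`, and a reduced genus
point `W_ℓ` (`2·W_ℓ = Y_ℓ`) no odd multiple of which is twice `ℚ(θ_ℓ)`-rational ⟹ `∃ (n, d, θ, T)`, certificate.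
[cite: GrossLMS1991, §3 (3.5), §4 (4.1), Lemma 4.3, §5] [cite: McCallumLMS1991, §5] -/
theorem heegner_exists_multiGenusCertificate_of_auxFieldPrimitive_levelOne [W.IsElliptic] [W.IsGloballyMinimal]
    (hK : IsImaginaryQuadratic K) (hodd : Odd (NumberField.discr K)) (h3 : NumberField.discr K ≠ -3)
    (hH : SatisfiesHeegnerHypothesis (W.conductorNorm ℤ) K) (hsurj : W.HasSurjectiveModNGaloisRep ((2 : ℤ) ^ 1))
    (d₁ : KolyvaginHeegnerData Dt β ι 1)
    (hM : ∃ Q₁ : (W.baseChange (ringClassField K ι 1)).toAffine.Point, (2 : ℤ) • Q₁ = d₁.derivedPoint)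
    (haux : ∃ (ℓ : ℕ) (d : KolyvaginHeegnerData Dt β ι ℓ) (θ : ℕ → ringClassField K ι ℓ)
      (G : Finset (ringClassField K ι ℓ ≃ₐ[ℚ] ringClassField K ι ℓ))
      (Wn : (W.baseChange (ringClassField K ι ℓ)).toAffine.Point) (s₀ : K) (dK : ℚ)
      (Wd : WeierstrassCurve ℚ) (_ : Wd.IsElliptic),
      ℓ.Prime ∧ (∀ ℓ' ∈ ℓ.primeFactors, Zhang2014.IsKolyvaginPrime (W.conductorNorm ℤ) W K 2 ℓ') ∧
      (∀ ℓ' ∈ ℓ.primeFactors, θ ℓ' ^ 2 = algebraMap ℚ (ringClassField K ι ℓ) ((-1 : ℚ) ^ (ℓ' / 2) * ℓ')) ∧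
      (∀ g, g ∈ G ↔ g ∈ ringClassGal ι ℓ) ∧
      s₀ ∉ Set.range (algebraMap ℚ K) ∧ s₀ ^ 2 = algebraMap ℚ K dK ∧
      (∃ C : WeierstrassCurve.VariableChange ℚ, C • W.quadraticTwist (((-1 : ℚ) ^ (ℓ / 2) * ℓ) * dK) = Wd) ∧
      Nat.card (Wd.selmerGroup 2) = 1 ∧
      ((2 : ℤ) ^ ℓ.primeFactors.card) • Wn =
        ∑ g ∈ G, (∏ ℓ' ∈ ℓ.primeFactors, (if g (θ ℓ') = θ ℓ' then (1 : ℤ) else -1)) •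
          pointGalHom W (ringClassField K ι ℓ) g d.y ∧
      ∀ m : ℕ, Odd m → ¬ ∃ Q : (W.baseChange (ringClassField K ι ℓ)).toAffine.Point,
        (∀ g : ringClassField K ι ℓ ≃ₐ[ℚ] ringClassField K ι ℓ, g (θ ℓ) = θ ℓ →
          pointGalHom W (ringClassField K ι ℓ) g Q = Q) ∧ (2 : ℤ) • Q = (m : ℤ) • Wn) :
    ∃ (n : ℕ) (d : KolyvaginHeegnerData Dt β ι n) (θ : ℕ → ringClassField K ι n)
      (T : Finset (ringClassField K ι n ≃ₐ[ℚ] ringClassField K ι n)),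
      Squarefree n ∧ (∀ ℓ ∈ n.primeFactors, Zhang2014.IsKolyvaginPrime (W.conductorNorm ℤ) W K 2 ℓ) ∧
      (∀ ℓ ∈ n.primeFactors, θ ℓ ^ 2 = algebraMap ℚ (ringClassField K ι n) ((-1 : ℚ) ^ (ℓ / 2) * ℓ)) ∧
      (∀ g, g ∈ T ↔ g ∈ ringClassGal ι n ∧ ∀ ℓ ∈ n.primeFactors, g (θ ℓ) = θ ℓ) ∧
      ¬ ∃ Q : (W.baseChange (ringClassField K ι n)).toAffine.Point, (2 : ℤ) • Q =
        ∑ g ∈ T, pointGalHom W (ringClassField K ι n) g d.y := by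
  obtain ⟨ℓ, d, θ, G, Wn, s₀, dK, Wd, _, hℓ, hKoly, hθ, hG, hs₀, hs₀2, hC, hSel, hWn, hprim⟩ := haux
  refine ⟨ℓ, d, θ, G.filter (fun g ↦ ∀ ℓ' ∈ ℓ.primeFactors, g (θ ℓ') = θ ℓ'), Irreducible.squarefree hℓ, hKoly, hθ,
    fun g ↦ by rw [Finset.mem_filter, hG], ?_⟩
  exact (heegner_certificate_iff_auxField_of_levelOne_of_card_selmerGroup_evenTwist_eq_one hK hodd h3 hH hsurj hℓ hKoly d₁ hM d hθ
    G hG _ (fun g ↦ by rw [Finset.mem_filter, hG]) hs₀ hs₀2 Wd hC hSel hWn).mpr hprim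

end Heegner

/-! ### §3 U BY NAME from the depth-one auxiliary-field form of `stub_positiveDepth` -/

section Crux

open Summit.BirchSwinnertonDyer.BirchSwinnertonDyer.Theses.GenusKolyvaginAtTwo

/-- **`MultiGenusPrimitivityAtTwo` (crux 24947) from the DEPTH-ONE auxiliary-field form of its open stub `stub_positiveDepth`**:
the hypothesis is the registered stub's binder list VERBATIM (crux binders + `2 ∣ P(1)`), concluding with the data of
`heegner_exists_multiGenusCertificate_of_auxFieldPrimitive_levelOne`; the `M₀ = 0` case is g4's landed `stub_levelOne` (via
`…OfStubs.multiGenusPrimitivityAtTwo_of_stubPositiveDepth`). CONDITIONAL on that hypothesis — whose SUPPLY half (a depth-one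
Kolyvagin prime whose even genus twist has `#Sel₂ = 1`) is gk2-p4's twisting-prime programme and whose PRIMITIVITY half is W. Zhang's
base case at `p = 2` read in `E(ℚ(√ℓ*)) ⊗ ℤ₂`; nothing else. [cite: GrossLMS1991, §3 (3.5), §4 (4.1), Lemma 4.3, §5]
[cite: McCallumLMS1991, §5] [cite: MazurRubin2010, Prop. 3.3, Cor. 3.4 (i)] [cite: WZhang2014, Thm. 1.1 (the p ≥ 5 prototype)] -/
theorem multiGenusPrimitivityAtTwo_of_auxFieldPrimitive_levelOne
    (haux : ∀ (W : WeierstrassCurve ℚ) [W.IsElliptic] [W.IsGloballyMinimal] [NeZero (W.conductorNorm ℤ)], ¬ W.HasCM →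
      W.analyticRank = 0 → (∀ n : ℕ, 0 < n → W.HasSurjectiveModNGaloisRep ((2 : ℤ) ^ n)) → Odd W.tamagawaProduct →
      ∀ (K : Type) [Field K] [NumberField K], Literature.NumberTheory.EllipticCurves.IsImaginaryQuadratic K →
      Odd (NumberField.discr K) → NumberField.discr K ≠ -3 →
      Literature.NumberTheory.EllipticCurves.SatisfiesHeegnerHypothesis (W.conductorNorm ℤ) K →
      ¬ IsSquare ((NumberField.discr K : ℚ) * -|W.Δ|) → ¬ IsSquare ((NumberField.discr K : ℚ) * (-(2 * |W.Δ|))) →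
      ∀ (Dt : Literature.NumberTheory.EllipticCurves.ModularForms.ModularParametrizationData W (W.conductorNorm ℤ)),
      (∀ z ∈ Dt.L.lattice, ∃ w ∈ Literature.NumberTheory.EllipticCurves.ModularForms.periodLattice Dt.f, z = (Dt.c : ℂ) * w) →
      Odd Dt.c → ∀ (β : ℤ) (ι : K →+* ℂ) (d₁ : Literature.NumberTheory.EllipticCurves.KolyvaginHeegnerData Dt β ι 1),
      ¬ IsOfFinAddOrder d₁.derivedPoint → ∀ (Wd : WeierstrassCurve ℚ) [Wd.IsElliptic] [Wd.IsGloballyMinimal],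
      (∃ C : WeierstrassCurve.VariableChange ℚ, C • W.quadraticTwist (NumberField.discr K : ℚ) = Wd) → Wd.analyticRank = 1 →
      Nat.card (Wd.selmerGroup 2) = 2 →
      (∃ Q : (W.baseChange (Literature.NumberTheory.EllipticCurves.ringClassField K ι 1)).toAffine.Point,
        (2 : ℤ) • Q = d₁.derivedPoint) →
      ∃ (ℓ : ℕ) (d : Literature.NumberTheory.EllipticCurves.KolyvaginHeegnerData Dt β ι ℓ)
        (θ : ℕ → Literature.NumberTheory.EllipticCurves.ringClassField K ι ℓ)
        (G : Finset (Literature.NumberTheory.EllipticCurves.ringClassField K ι ℓ ≃ₐ[ℚ]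
          Literature.NumberTheory.EllipticCurves.ringClassField K ι ℓ))
        (Wn : (W.baseChange (Literature.NumberTheory.EllipticCurves.ringClassField K ι ℓ)).toAffine.Point)
        (s₀ : K) (dK : ℚ) (We : WeierstrassCurve ℚ) (_ : We.IsElliptic),
        ℓ.Prime ∧
        (∀ ℓ' ∈ ℓ.primeFactors, Literature.NumberTheory.EllipticCurves.Zhang2014.IsKolyvaginPrime (W.conductorNorm ℤ) W K 2 ℓ') ∧
        (∀ ℓ' ∈ ℓ.primeFactors, θ ℓ' ^ 2 =
          algebraMap ℚ (Literature.NumberTheory.EllipticCurves.ringClassField K ι ℓ) ((-1 : ℚ) ^ (ℓ' / 2) * ℓ')) ∧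
        (∀ g, g ∈ G ↔ g ∈ Literature.NumberTheory.EllipticCurves.ringClassGal ι ℓ) ∧
        s₀ ∉ Set.range (algebraMap ℚ K) ∧ s₀ ^ 2 = algebraMap ℚ K dK ∧
        (∃ C : WeierstrassCurve.VariableChange ℚ, C • W.quadraticTwist (((-1 : ℚ) ^ (ℓ / 2) * ℓ) * dK) = We) ∧
        Nat.card (We.selmerGroup 2) = 1 ∧
        ((2 : ℤ) ^ ℓ.primeFactors.card) • Wn =
          ∑ g ∈ G, (∏ ℓ' ∈ ℓ.primeFactors, (if g (θ ℓ') = θ ℓ' then (1 : ℤ) else -1)) •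
            Literature.NumberTheory.EllipticCurves.pointGalHom W
              (Literature.NumberTheory.EllipticCurves.ringClassField K ι ℓ) g d.y ∧
        ∀ m : ℕ, Odd m →
          ¬ ∃ Q : (W.baseChange (Literature.NumberTheory.EllipticCurves.ringClassField K ι ℓ)).toAffine.Point,
            (∀ g : Literature.NumberTheory.EllipticCurves.ringClassField K ι ℓ ≃ₐ[ℚ]
                Literature.NumberTheory.EllipticCurves.ringClassField K ι ℓ, g (θ ℓ) = θ ℓ →
              Literature.NumberTheory.EllipticCurves.pointGalHom W
                (Literature.NumberTheory.EllipticCurves.ringClassField K ι ℓ) g Q = Q) ∧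
            (2 : ℤ) • Q = (m : ℤ) • Wn) :
    MultiGenusPrimitivityAtTwo := by
  refine MultiGenusPrimitivityAtTwo.multiGenusPrimitivityAtTwo_of_stubPositiveDepth ?_
  intro W _ _ _ hcm hr0 hρ hT K _ _ hIQ hodd h3 hHe hsq1 hsq2 Dt hopt hc β ι d₁ hy Wd _ _ hWd hrd hSel hM
  have hsurj : W.HasSurjectiveModNGaloisRep ((2 : ℤ) ^ 1) := hρ 1 one_pos
  exact heegner_exists_multiGenusCertificate_of_auxFieldPrimitive_levelOne hIQ hodd h3 hHe hsurj d₁ hM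
    (haux W hcm hr0 hρ hT K hIQ hodd h3 hHe hsq1 hsq2 Dt hopt hc β ι d₁ hy Wd hWd hrd hSel hM)

end Crux

end Summit.BirchSwinnertonDyer.BirchSwinnertonDyer.Theorems.GenusKoly

end
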